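import Summits.BirchSwinnertonDyer.BirchSwinnertonDyer.Theorems.KatoDescentTamePotSupersingularTameUpperNonsurjTowerFineSelmer
import Summits.BirchSwinnertonDyer.BirchSwinnertonDyer.Theorems.KatoDescentTamePotSupersingularTameUpperDefectOfSplit
import Summits.BirchSwinnertonDyer.BirchSwinnertonDyer.Theorems.KatoDescentTamePotSupersingularTameUpperReducibleOfHull
import HarnessLib

/-!
# Route `KatoDescentTamePotSupersingular` (rung K8, sub-rung B4 (t′), cell `bsd-potss`): the U₀ node
# `TameUpperDefectRankZero` (item stmt-BirchSwinnertonDyer-19982) and its child `TameUpperNonsurjTower`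
# (item 19202) BY NAME FROM THE ROUTE'S OWN ITEMS after the rev-4 re-cut — and U₀'s exact bill once the
# reducible child is read in crux M's hull currency (a `--supports … --as helper` file; nothing is closed)

After the tenure re-cut of 2026-08-26T05:09Z (route rev 4) the U₀-ns child `TameUpperNonsurjTower` (item
19202) is DERIVED inside `closes` from the crux `TameFineSelmerCoatesSujatha` (item 19413: Coates–Sujatha's
Conjecture A on the non-CM irreducible non-tower-surjective (t′) rank-`0` rows, in the ∃-form over
`WeierstrassCurve.FineSelmerDualData`) and the cite-level supports `PublishedInputsFineSelmerCM` (item 19387: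
Kato's Tamagawa-exact bound in the FINE-SELMER reading — this seat's Literature fact p420034 — ∧ the CM triple
of Burungale–Flach) and `KatoTamagawaExactInputs` (item 19191: A161″ ∧ GZK ∧ modularity); the parent U₀ then
comes from the proved split glue (item 19204, `tameUpperDefectOfSplit_proof`) and the reducible child
`TameUpperReducibleDefect` (item 19203). This file exports those two derivations as NAMED theorems whose
hypotheses are route items BY NAME (§1: `tameUpperNonsurjTower_of_items`, `tameUpperDefectRankZero_of_items`
— the terms the deciding theorem inlines), and states U₀'s exact bill when the reducible child is read, as
the kmc seat does, from crux M's sharpened hull readings M1/M2/M3♯ + Cassels (§2: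
`tameUpperDefectRankZero_of_items_of_hullReadingsSharp` — U₀ on (t′) ⟸ Conjecture A on the 411-type rows +
the readings that also carry `ReducibleKatoMember` + cite-level inputs). CONDITIONAL over route items /
displayed readings (audit `proof.conditional`); nothing about Conjecture A, Kato's objects or the named
facts is asserted; NO item is closed by this file. Seat `bsd-potss-k8t-c4` generation 2.

References: [Kato2004Asterisque] Thm. 12.5 (3) (p. 222), Thm. 12.6 (p. 222), Thm. 14.5 (3) (p. 236), §14.14,
Prop. 14.16 (2) (p. 244); [CoatesSujatha2005] Conj. A, Thm. 3.4; [Lim2017FineSelmer] §3;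
[BurungaleFlach2024] Thm. 1.1, Cor. 2; [Wuthrich2014] Lemma 14 (p. 396); [GreenbergLNM1716] Prop. 4.13;
[Cassels1965ArithmeticVIII].
-/

set_option autoImplicit false
-- sibling precedent (`KatoDescentPotSupersingularAssembly.lean`): the directory name repeats the summit name
set_option linter.dupNamespace false

noncomputable section

open scoped Classical

namespace Summit.BirchSwinnertonDyer.BirchSwinnertonDyer.Theorems

open WeierstrassCurve Literature.NumberTheory.EllipticCurves
  Literature.NumberTheory.EllipticCurves.Rank1Residual
  Literature.NumberTheory.EllipticCurves.Rank1Residual.Typed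
  Summit.BirchSwinnertonDyer.Rank1Residual.Additive
  Summit.BirchSwinnertonDyer.Rank1Residual
  Summit.BirchSwinnertonDyer.BirchSwinnertonDyer.Theses.KatoDescentTamePotSupersingular

variable {IsHullOf : ∀ (W : WeierstrassCurve ℚ) [W.IsElliptic] [W.IsGloballyMinimal] (p : ℕ)
  [Fact p.Prime], KatoHullDescentDatum p → Prop}

/-! ## §1 The U₀ nodes by name from route items (the terms inlined in the deciding theorem) -/

/-- **Item 19202 `TameUpperNonsurjTower` BY NAME from the route items 19387 ∧ 19191 ∧ 19413**: the
fine-Selmer reading of Kato's Tamagawa-exact bound and the CM triple (`PublishedInputsFineSelmerCM`),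
GZK and modularity (from `KatoTamagawaExactInputs`; its A161″ conjunct is not used here), and
Coates–Sujatha's (A) on the non-CM rows (`TameFineSelmerCoatesSujatha`) — by this seat's
`tameUpperNonsurjTower_of_cm_of_fineSelmerDual_fg` (CM rows: row C8 `bsdp_cm_rankZero`; non-CM rows:
`missingUpperBoundAt_tame_of_irreducible_of_fineSelmerDual_fg`). Conditional over items; nothing asserted;
no item is closed. [cite: Kato2004Asterisque, Thm. 12.5 (3) (p. 222), Thm. 14.5 (3) (p. 236), Prop. 14.16 (2) (p. 244)]
[cite: CoatesSujatha2005, Conjecture A and Thm. 3.4] [cite: BurungaleFlach2024, Thm. 1.1 and Cor. 2 (p. 4)] -/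
theorem tameUpperNonsurjTower_of_items (hF : PublishedInputsFineSelmerCM) (hK : KatoTamagawaExactInputs)
    (hCS : TameFineSelmerCoatesSujatha) :
    Summit.BirchSwinnertonDyer.BirchSwinnertonDyer.Theses.KatoDescentTamePotSupersingular.TameUpperNonsurjTower :=
  tameUpperNonsurjTower_of_cm_of_fineSelmerDual_fg hF.1 hF.2 hK.2.2 hK.2.1
    fun W _ _ p _ hr hp2 hadd hT hcm hI hns ↦ hCS W p hr hp2 hadd hT hI hns hcm

/-- **Item 19982 `TameUpperDefectRankZero` (U₀) BY NAME from the route items 19387 ∧ 19191 ∧ 19413 ∧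
19203**: §1's derivation of the U₀-ns child, the reducible child `TameUpperReducibleDefect` as a
hypothesis, and the proved split glue `tameUpperDefectOfSplit_proof` (item 19204; tower-surjective
irreducible rows by A161″ + GZK + modularity). The term the deciding theorem inlines (`hS h₄a h₄b hK`).
Conditional over items; nothing asserted; no item is closed.
[cite: Kato2004Asterisque, Thm. 14.5 (3) (p. 236), Prop. 14.16 (2) (p. 244), §14.8 (p. 238)]
[cite: GreenbergLNM1716, §4 Prop. 4.13] [cite: CoatesSujatha2005, Conjecture A] -/
theorem tameUpperDefectRankZero_of_items (hF : PublishedInputsFineSelmerCM)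
    (hK : KatoTamagawaExactInputs) (hCS : TameFineSelmerCoatesSujatha) (h₄b : TameUpperReducibleDefect) :
    Summit.BirchSwinnertonDyer.BirchSwinnertonDyer.Theses.KatoDescentTamePotSupersingular.TameUpperDefectRankZero :=
  tameUpperDefectOfSplit_proof (tameUpperNonsurjTower_of_items hF hK hCS) h₄b hK

/-! ## §2 U₀'s exact bill with the reducible child in crux M's hull currency -/

/-- **U₀ on (t′) — `TameUpperDefectRankZero` — from Coates–Sujatha's (A) on its non-CM irreducible
non-tower-surjective rows (item 19413), the cite-level items 19387 ∧ 19191, and crux M's SHARPENED HULL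
READINGS M1 (Kato's member carries a realised hull datum), M2 (divisibility for the hull on reducible
rows: Thm. 12.5 (3) off `(p)`, Wuthrich's Lemma 14 at `(p)`), M3♯ (the exact rank-`0` count) with Cassels'
isogeny invariance** — the reducible child `TameUpperReducibleDefect` being DISCHARGED over those readings
by the kmc seat's `tameUpperReducibleDefect_of_hullReadingsSharp` (no `ℤ/p²` / parity hypothesis used).
So U₀(t′) costs exactly: (A) on the 411-type rows + the readings that ALSO pay for `ReducibleKatoMember`
+ published inputs. Conditional over items / displayed readings; nothing asserted; no item is closed.
[cite: Kato2004Asterisque, Thm. 12.5 (3), Thm. 12.6 (p. 222), §14.14 (p. 243), Prop. 14.16 (2) (p. 244)]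
[cite: Wuthrich2014, §3.2 and Lemma 14 (pp. 394–396)] [cite: Cassels1965ArithmeticVIII]
[cite: CoatesSujatha2005, Conjecture A] -/
theorem tameUpperDefectRankZero_of_items_of_hullReadingsSharp (hF : PublishedInputsFineSelmerCM)
    (hK : KatoTamagawaExactInputs) (hCS : TameFineSelmerCoatesSujatha)
    (hM : KatoHull.MemberRealizable IsHullOf) (hD : KatoHull.DivisibilityReading IsHullOf)
    (hC : KatoHull.ExactCountReading IsHullOf) (hCassels : bsdRHS_eq_of_isIsogenous) :
    Summit.BirchSwinnertonDyer.BirchSwinnertonDyer.Theses.KatoDescentTamePotSupersingular.TameUpperDefectRankZero :=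
  tameUpperDefectRankZero_of_items hF hK hCS
    (tameUpperReducibleDefect_of_hullReadingsSharp hM hD hC hCassels hK.2.1 hK.2.2)

end Summit.BirchSwinnertonDyer.BirchSwinnertonDyer.Theorems

end
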